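import Literature.Barriers.Parity.SiegelZeroDichotomyPairHLLemma34
import Literature.Barriers.Parity.SiegelZeroDichotomyPairHLLemma51
import Literature.Barriers.Parity.SiegelZeroDichotomyPairHLEq59
import Literature.NumberTheory.Sieve.DivisorBound
import Literature.Barriers.Parity.SiegelZeroDichotomyPairHLEq58Euler
import HarnessLib

/-!
# Tao–Teräväinen 2022, (5.8) at `k = 2`, `ℓ = 0` — proved

Topic `Literature/Barriers/Parity`. This file DISCHARGES the named fact
`Literature.Barriers.Parity.TaoTeravainen2021_eq58_pair` of `SiegelZeroDichotomyPairHLStepTwo.lean`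
("`𝔼_{n ≤ x} F(n+h₁) ∏_{j=2}^k (Λν + F + G)(n+h_j) ≈ 0`", Tao–Teräväinen arXiv:2109.06291, §5, proof of
Proposition 5.2, (5.8)) by the printed argument:

1. Pointwise, with `W(m) = ∑_{d ≤ D, d∣m} τ_{(≤R₀)}(d)^A` (so `F = (W-1) ν log x`):
   `(Λν + F + G)(m) ≤ 3 log(2x) W(m) ν(m)` (`Λ ≤ log`; `G(m) ≤ log(2x) ν(m)` since `ν(m) = ν(m/p*)` for
   the at most one prime `p* > √(2x) ≥ R` dividing `m`) — `sum_errF_mul_le` reduces the sum to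
   `3 log x log(2x) ∑_{d₁>1,d₂} w(d₁)w(d₂) ∑_n ν(n+h₁)1_{d₁∣n+h₁}ν(n+h₂)1_{d₂∣n+h₂}`
   ("it suffices to show that `(log^k x) ∑_{d_j ≤ D, d₁>1} (∏ τ_{(≤R₀)}(d_j)^{O(1)}) 𝔼 ∏ 1_{d_j∣n+h_j}ν(n+h_j) ≈ 0`").
2. Lemma 3.4 in the weighted form (`sieveCorrelation_weighted_le`, `…Lemma34.lean`) with the
   hypothesis supplied by `fWeight_gain_sum_le` (this file; Euler products and (3.3) from
   `…Eq58Euler.lean`): main term `≪ x log x log(2x) · log_R R₀/log² R`, error `(B⌈R⌉)⁴ ∑ w w`.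
3. `∑ w(d₁)w(d₂) ≤ C_τ^{2A} D^{5/2}` by the divisor bound (`fWeight_sum_le`), and the scales
   `R = x^{1/log^{1/10}η}`, `R₀ = x^{1/√log η}`, `D = x^{ε₀/20}` (`ε₀ ≤ ε₁ = 1`) with Siegel's bound
   (1.4) (`log η ≤ c_S log x`) give `main ≤ C x/log^{1/5} η`, `error ≤ C x e^{-log x/8} ≤ C x/log^{1/20} η`.
[cite: TaoTeravainen2021, §5, proof of Proposition 5.2, (5.8); Lemma 3.4; (2.11), (3.3); (2.3)–(2.5); (1.4)]
-/

noncomputable section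

open Finset
open scoped ArithmeticFunction.vonMangoldt ArithmeticFunction.Moebius

namespace Literature.Barriers.Parity

namespace TaoTeravainen

variable {q : ℕ} (χ : DirichletCharacter ℂ q)

/-! ### The divisor weights of `F` on a fixed index range -/

/-- The weight `τ_{(≤R₀)}(d)^A 1_{d ≤ D}` of (5.5), with the smoothness threshold `⌊R₀⌋ + 1`.
[cite: TaoTeravainen2021, Lemma 5.1 (5.5)] -/
def fWeight (R₀ Dr : ℝ) (A : ℕ) (d : ℕ) : ℝ :=
  if (d : ℝ) ≤ Dr ∧ d ∈ Nat.smoothNumbers (⌊R₀⌋₊ + 1) then ((d.divisors.card : ℕ) : ℝ) ^ A else 0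

/-- `fWeight ≥ 0`. [folklore] -/
theorem fWeight_nonneg (R₀ Dr : ℝ) (A d : ℕ) : 0 ≤ fWeight R₀ Dr A d := by
  unfold fWeight
  split_ifs <;> positivity

/-- `fWeight 1 = 1` when `Dr ≥ 1`. [folklore] -/
theorem fWeight_one {R₀ Dr : ℝ} (hDr : 1 ≤ Dr) (A : ℕ) : fWeight R₀ Dr A 1 = 1 := by
  have h1 : (1 : ℕ) ∈ Nat.smoothNumbers (⌊R₀⌋₊ + 1) := by
    rw [Nat.mem_smoothNumbers]
    exact ⟨one_ne_zero, fun p hp => absurd hp (by simp)⟩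
  unfold fWeight
  rw [if_pos ⟨by exact_mod_cast hDr, h1⟩]
  simp

/-- `fWeight d = 0` for `d > Dr`. [folklore] -/
theorem fWeight_eq_zero_of_lt {R₀ Dr : ℝ} {A d : ℕ} (hd : Dr < d) : fWeight R₀ Dr A d = 0 := by
  unfold fWeight
  rw [if_neg]
  exact fun h => (not_le.mpr hd) h.1

/-- The index range `T = [1, ⌊D⌋]`. [folklore] -/
def fRange (Dr : ℝ) : Finset ℕ :=
  Finset.Icc 1 ⌊Dr⌋₊

/-- **`W(m) = ∑_{d ≤ D : d ∣ m} τ_{(≤R₀)}(d)^A` over the fixed range** and its relation to the divisor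
sum of `F`: `errFSum(m) = ∑_{d ∈ T} 1_{d>1} fWeight(d) 1_{d∣m}` and `W(m) = errFSum(m) + 1` (`m ≥ 1`,
`D ≥ 1`). [cite: TaoTeravainen2021, Lemma 5.1 (5.5)] -/
theorem errFSum_eq_sum_fRange {R₀ Dr : ℝ} (A : ℕ) {m : ℕ} (hm : m ≠ 0) :
    errFSum R₀ Dr A m =
      ∑ d ∈ fRange Dr, (if 1 < d then fWeight R₀ Dr A d else 0) * (if d ∣ m then 1 else 0) := by
  classical
  unfold errFSum
  have hpt : ∀ d : ℕ, (if 1 < d ∧ (d : ℝ) ≤ Dr ∧ d ∈ Nat.smoothNumbers (⌊R₀⌋₊ + 1) then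
      ((d.divisors.card : ℕ) : ℝ) ^ A else 0) = (if 1 < d then fWeight R₀ Dr A d else 0) := by
    intro d
    unfold fWeight
    by_cases h1 : 1 < d
    · by_cases h2 : ((d : ℝ) ≤ Dr ∧ d ∈ Nat.smoothNumbers (⌊R₀⌋₊ + 1))
      · rw [if_pos ⟨h1, h2⟩, if_pos h1, if_pos h2]
      · rw [if_neg (fun h => h2 h.2), if_pos h1, if_neg h2]
    · rw [if_neg (fun h => h1 h.1), if_neg h1]
  rw [Finset.sum_congr rfl fun d _ => hpt d]
  have hrhs : ∑ d ∈ fRange Dr, (if 1 < d then fWeight R₀ Dr A d else 0) * (if d ∣ m then (1 : ℝ) else 0) =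
      ∑ d ∈ (fRange Dr).filter (fun d => d ∣ m), (if 1 < d then fWeight R₀ Dr A d else 0) := by
    rw [Finset.sum_filter]
    refine Finset.sum_congr rfl fun d _ => ?_
    split_ifs <;> simp
  rw [hrhs]
  have hsub : (fRange Dr).filter (fun d => d ∣ m) ⊆ m.divisors := by
    intro d hd
    rw [Finset.mem_filter] at hd
    exact Nat.mem_divisors.mpr ⟨hd.2, hm⟩
  refine (Finset.sum_subset hsub fun d hd hnot => ?_).symm
  -- a divisor outside the range exceeds `Dr`, where the weight vanishes
  have hd1 : 1 ≤ d := Nat.pos_of_mem_divisors hd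
  have hdm : d ∣ m := Nat.dvd_of_mem_divisors hd
  have hlt : Dr < d := by
    by_contra h
    push Not at h
    exact hnot (Finset.mem_filter.mpr ⟨Finset.mem_Icc.mpr ⟨hd1, Nat.le_floor h⟩, hdm⟩)
  simp [fWeight_eq_zero_of_lt hlt]

/-- The full weight sum `W(m) = ∑_{d ∈ T} fWeight(d) 1_{d∣m}` equals `errFSum(m) + 1` (`m ≥ 1`, `D ≥ 1`).
[cite: TaoTeravainen2021, Lemma 5.1 (5.5)] -/
theorem sum_fWeight_eq {R₀ Dr : ℝ} (hDr : 1 ≤ Dr) (A : ℕ) {m : ℕ} (hm : m ≠ 0) :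
    ∑ d ∈ fRange Dr, fWeight R₀ Dr A d * (if d ∣ m then 1 else 0) = errFSum R₀ Dr A m + 1 := by
  classical
  rw [errFSum_eq_sum_fRange A hm]
  have h1mem : 1 ∈ fRange Dr := Finset.mem_Icc.mpr ⟨le_rfl, Nat.le_floor (by exact_mod_cast hDr)⟩
  rw [← Finset.add_sum_erase _ _ h1mem, ← Finset.add_sum_erase _ _ h1mem]
  simp only [lt_self_iff_false, if_false, zero_add, one_dvd, if_true, mul_one,
    fWeight_one hDr]
  rw [add_comm]
  congr 1
  refine Finset.sum_congr rfl fun d hd => ?_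
  have hd1 : 1 < d := by
    have := Finset.mem_erase.mp hd
    have h2 := (Finset.mem_Icc.mp this.2).1
    omega
  rw [if_pos hd1]


/-! ### The pointwise reduction of (5.8) to Lemma 3.4 -/

/-- `G(m) ≤ log(2x) ν(m)` for `1 ≤ m ≤ 2x`, `1 < R ≤ √x`: a non-zero term `Λν(m/p*)` has
`ν(m) = ν(m/p*)` (`p* > √(2x) ≥ R`) and at most one prime `> √(2x)` divides `m`.
[cite: TaoTeravainen2021, §5 (proof of (5.8): "`(Λν + F + G)(n+h_{j'}) ≪ (∑_{d_j ≤ D:d_j∣n+h_j} τ_{(≤R₀)}(d_j)^{O(1)}) ν(n+h_j) log x`")] -/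
theorem errG_le_log_mul_selbergSieve {ψ : ℝ → ℝ} (hψ : IsSmoothCutoff ψ) {R : ℝ} (hR : 1 < R)
    {x m : ℕ} (hRx : R ≤ Real.sqrt x) (hm : 1 ≤ m) (hmx : m ≤ 2 * x) :
    errG χ ψ R x m ≤ Real.log (2 * x) * selbergSieve ψ R m := by
  have hmx' : (m : ℝ) ≤ 2 * x := by exact_mod_cast hmx
  have hx1 : (1 : ℝ) ≤ 2 * x := le_trans (by exact_mod_cast hm) hmx'
  have hlog2x : 0 ≤ Real.log (2 * x) := Real.log_nonneg hx1
  have hν0 := selbergSieve_nonneg ψ R m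
  have hRle : R ≤ Real.sqrt (2 * x) := hRx.trans (Real.sqrt_le_sqrt (by
    have : (0 : ℝ) ≤ x := Nat.cast_nonneg x
    linarith))
  unfold errG
  set P := (Finset.range (m + 1)).filter (fun p : ℕ =>
      p.Prime ∧ realChar χ p ≠ -1 ∧ Real.sqrt (2 * x) < (p : ℝ) ∧ (p : ℝ) ≤ 2 * x / Real.sqrt R ∧
        p ∣ m) with hPdef
  have hterm : ∀ p ∈ P, sievedVonMangoldt ψ R (m / p) ≤ Real.log (2 * x) * selbergSieve ψ R m := by
    intro p hp
    rw [hPdef, Finset.mem_filter] at hp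
    obtain ⟨-, hpp, -, hpsq, -, hpm⟩ := hp
    have hν : selbergSieve ψ R m = selbergSieve ψ R (m / p) := by
      conv_lhs => rw [← Nat.div_mul_cancel hpm]
      exact selbergSieve_mul_prime hψ hR hpp (hRle.trans hpsq.le) (m / p)
    rw [hν]
    unfold sievedVonMangoldt
    have h0 : 0 ≤ selbergSieve ψ R (m / p) := selbergSieve_nonneg ψ R _
    have hΛ : Λ (m / p) ≤ Real.log (2 * x) := by
      refine ArithmeticFunction.vonMangoldt_le_log.trans ?_
      rcases Nat.eq_zero_or_pos (m / p) with h | hpos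
      · rw [h]; simp [hlog2x]
      · exact Real.log_le_log (by exact_mod_cast hpos)
          (le_trans (by exact_mod_cast Nat.div_le_self m p) hmx')
    exact mul_le_mul_of_nonneg_right hΛ h0
  have hcard : #P ≤ 1 := by
    have hsub : P ⊆ (Finset.range (m + 1)).filter (fun p : ℕ =>
        p.Prime ∧ realChar χ p ≠ -1 ∧ Real.sqrt (2 * x) < (p : ℝ) ∧ p ∣ m) := by
      intro p hp
      rw [hPdef, Finset.mem_filter] at hp
      rw [Finset.mem_filter]
      exact ⟨hp.1, hp.2.1, hp.2.2.1, hp.2.2.2.1, hp.2.2.2.2.2⟩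
    exact (Finset.card_le_card hsub).trans (card_filter_prime_gt_sqrt_dvd_le_one hm hmx' _ _)
  calc ∑ p ∈ P, sievedVonMangoldt ψ R (m / p)
      ≤ ∑ _p ∈ P, Real.log (2 * x) * selbergSieve ψ R m := Finset.sum_le_sum hterm
    _ = #P * (Real.log (2 * x) * selbergSieve ψ R m) := by rw [Finset.sum_const, nsmul_eq_mul]
    _ ≤ 1 * (Real.log (2 * x) * selbergSieve ψ R m) := by
        exact mul_le_mul_of_nonneg_right (by exact_mod_cast hcard) (by positivity)
    _ = _ := one_mul _

/-- **The reduction of (5.8) to the weighted correlation sums of Lemma 3.4**: with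
`W(m) = ∑_{d ≤ D, d ∣ m} τ_{(≤R₀)}(d)^A` (so that `F = (W - 1) ν log x`,
`(Λν + F + G)(m) ≤ 3 log(2x) W(m) ν(m)`), for `h₁, h₂ ≤ x`, `1 < R ≤ √x`, `D ≥ 1`:
`∑_{n ≤ x} F(n+h₁)(Λν + F + G)(n+h₂) ≤ 3 log x log(2x) ∑_{d₁,d₂ ∈ T} 1_{d₁>1} w(d₁) w(d₂) S(d₁,d₂)`
("it suffices to show that `(log^k x) ∑_{d₁,…,d_k ≤ D: d₁>1} (∏ τ_{(≤R₀)}(d_j)^{O(1)}) 𝔼_{n ≤ x} ∏ 1_{d_j∣n+h_j} ν(n+h_j) ≈ 0`").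
[cite: TaoTeravainen2021, §5 (proof of (5.8), reduction)] -/
theorem sum_errF_mul_le {ψ : ℝ → ℝ} (hψ : IsSmoothCutoff ψ) {R : ℝ} (hR : 1 < R) {x h₁ h₂ : ℕ}
    (hRx : R ≤ Real.sqrt x) (hh₂ : h₂ ≤ x) (hx : 2 ≤ x) (R₀ : ℝ) {Dr : ℝ} (hDr : 1 ≤ Dr)
    (A : ℕ) :
    ∑ n ∈ Icc 1 x, errF ψ R R₀ Dr A x (n + h₁) *
        (sievedVonMangoldt ψ R (n + h₂) + errF ψ R R₀ Dr A x (n + h₂) + errG χ ψ R x (n + h₂)) ≤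
      3 * Real.log x * Real.log (2 * x) *
        ∑ d₁ ∈ fRange Dr, ∑ d₂ ∈ fRange Dr,
          (if 1 < d₁ then fWeight R₀ Dr A d₁ else 0) * fWeight R₀ Dr A d₂ *
            sieveCorrelation ψ R h₁ h₂ ![d₁, d₂] x := by
  classical
  have hx2 : (2 : ℝ) ≤ x := by exact_mod_cast hx
  have hx1 : (1 : ℝ) ≤ x := by linarith
  have hlogx : 0 ≤ Real.log x := Real.log_nonneg hx1
  have hlog2x : Real.log x ≤ Real.log (2 * x) := Real.log_le_log (by linarith) (by linarith)
  have hlog2x0 : 0 ≤ Real.log (2 * x) := hlogx.trans hlog2x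
  set T := fRange Dr with hT
  set w : ℕ → ℝ := fun d => fWeight R₀ Dr A d with hw
  set w' : ℕ → ℝ := fun d => if 1 < d then fWeight R₀ Dr A d else 0 with hw'
  have hw0 : ∀ d, 0 ≤ w d := fun d => fWeight_nonneg _ _ _ _
  have hw'0 : ∀ d, 0 ≤ w' d := fun d => by
    simp only [hw']
    split_ifs
    · exact fWeight_nonneg _ _ _ _
    · exact le_rfl
  -- pointwise
  have hpt : ∀ n ∈ Icc 1 x,
      errF ψ R R₀ Dr A x (n + h₁) *
          (sievedVonMangoldt ψ R (n + h₂) + errF ψ R R₀ Dr A x (n + h₂) + errG χ ψ R x (n + h₂)) ≤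
        3 * Real.log x * Real.log (2 * x) * ∑ d₁ ∈ T, ∑ d₂ ∈ T, w' d₁ * w d₂ *
          ((selbergSieve ψ R (n + h₁) * (if d₁ ∣ n + h₁ then 1 else 0)) *
            (selbergSieve ψ R (n + h₂) * (if d₂ ∣ n + h₂ then 1 else 0))) := by
    intro n hn
    rw [Finset.mem_Icc] at hn
    obtain ⟨hn1, hnx⟩ := hn
    have hm1 : n + h₁ ≠ 0 := by omega
    have hm2 : n + h₂ ≠ 0 := by omega
    set ν₁ := selbergSieve ψ R (n + h₁) with hν₁
    set ν₂ := selbergSieve ψ R (n + h₂) with hν₂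
    have hν₁0 : 0 ≤ ν₁ := selbergSieve_nonneg ψ R _
    have hν₂0 : 0 ≤ ν₂ := selbergSieve_nonneg ψ R _
    set W₂ := ∑ d ∈ T, w d * (if d ∣ n + h₂ then (1 : ℝ) else 0) with hW₂
    set W₁' := ∑ d ∈ T, w' d * (if d ∣ n + h₁ then (1 : ℝ) else 0) with hW₁'
    have hW₂eq : W₂ = errFSum R₀ Dr A (n + h₂) + 1 := sum_fWeight_eq hDr A hm2
    have hW₁'eq : W₁' = errFSum R₀ Dr A (n + h₁) := (errFSum_eq_sum_fRange A hm1).symm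
    have hFS0 : 0 ≤ errFSum R₀ Dr A (n + h₂) := errFSum_nonneg _ _ _ _
    have hW₂1 : 1 ≤ W₂ := by linarith
    have hW₁'0 : 0 ≤ W₁' := by rw [hW₁'eq]; exact errFSum_nonneg _ _ _ _
    -- the three bounds for the second factor
    have hmx2 : n + h₂ ≤ 2 * x := by omega
    have hlogm : Real.log ((n + h₂ : ℕ) : ℝ) ≤ Real.log (2 * x) :=
      Real.log_le_log (by exact_mod_cast Nat.pos_of_ne_zero hm2) (by exact_mod_cast hmx2)
    have hΛν : sievedVonMangoldt ψ R (n + h₂) ≤ Real.log (2 * x) * ν₂ * W₂ := by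
      unfold sievedVonMangoldt
      calc Λ (n + h₂) * selbergSieve ψ R (n + h₂) ≤ Real.log (2 * x) * ν₂ :=
            mul_le_mul_of_nonneg_right (ArithmeticFunction.vonMangoldt_le_log.trans hlogm) hν₂0
        _ = Real.log (2 * x) * ν₂ * 1 := (mul_one _).symm
        _ ≤ Real.log (2 * x) * ν₂ * W₂ := mul_le_mul_of_nonneg_left hW₂1 (by positivity)
    have hF₂ : errF ψ R R₀ Dr A x (n + h₂) ≤ Real.log (2 * x) * ν₂ * W₂ := by
      rw [errF_eq]
      calc errFSum R₀ Dr A (n + h₂) * selbergSieve ψ R (n + h₂) * Real.log x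
          ≤ W₂ * ν₂ * Real.log (2 * x) :=
            mul_le_mul (mul_le_mul_of_nonneg_right (by linarith) hν₂0) hlog2x hlogx (by positivity)
        _ = Real.log (2 * x) * ν₂ * W₂ := by ring
    have hG₂ : errG χ ψ R x (n + h₂) ≤ Real.log (2 * x) * ν₂ * W₂ := by
      calc errG χ ψ R x (n + h₂) ≤ Real.log (2 * x) * ν₂ :=
            errG_le_log_mul_selbergSieve χ hψ hR hRx (by omega) hmx2
        _ = Real.log (2 * x) * ν₂ * 1 := (mul_one _).symm
        _ ≤ Real.log (2 * x) * ν₂ * W₂ := mul_le_mul_of_nonneg_left hW₂1 (by positivity)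
    have hsecond : sievedVonMangoldt ψ R (n + h₂) + errF ψ R R₀ Dr A x (n + h₂) + errG χ ψ R x (n + h₂) ≤
        3 * Real.log (2 * x) * ν₂ * W₂ := by linarith
    have hsecond0 : 0 ≤ sievedVonMangoldt ψ R (n + h₂) + errF ψ R R₀ Dr A x (n + h₂) + errG χ ψ R x (n + h₂) :=
      add_nonneg (add_nonneg (sievedVonMangoldt_nonneg ψ R _) (errF_nonneg _ _ _ _ _ _ _))
        (errG_nonneg _ _ _ _ _)
    have hF₁ : errF ψ R R₀ Dr A x (n + h₁) = W₁' * ν₁ * Real.log x := by rw [errF_eq, hW₁'eq]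
    have hF₁0 : 0 ≤ errF ψ R R₀ Dr A x (n + h₁) := errF_nonneg _ _ _ _ _ _ _
    -- multiply
    calc errF ψ R R₀ Dr A x (n + h₁) *
          (sievedVonMangoldt ψ R (n + h₂) + errF ψ R R₀ Dr A x (n + h₂) + errG χ ψ R x (n + h₂))
        ≤ (W₁' * ν₁ * Real.log x) * (3 * Real.log (2 * x) * ν₂ * W₂) := by
          rw [hF₁] at hF₁0 ⊢
          exact mul_le_mul_of_nonneg_left hsecond hF₁0
      _ = 3 * Real.log x * Real.log (2 * x) * ((W₁' * ν₁) * (W₂ * ν₂)) := by ring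
      _ = 3 * Real.log x * Real.log (2 * x) * ∑ d₁ ∈ T, ∑ d₂ ∈ T, w' d₁ * w d₂ *
          ((ν₁ * (if d₁ ∣ n + h₁ then 1 else 0)) * (ν₂ * (if d₂ ∣ n + h₂ then 1 else 0))) := by
          congr 1
          rw [hW₁', hW₂, Finset.sum_mul, Finset.sum_mul, Finset.sum_mul]
          refine Finset.sum_congr rfl fun d₁ _ => ?_
          rw [Finset.mul_sum]
          refine Finset.sum_congr rfl fun d₂ _ => ?_
          ring
  -- sum over `n` and exchange
  calc ∑ n ∈ Icc 1 x, errF ψ R R₀ Dr A x (n + h₁) *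
          (sievedVonMangoldt ψ R (n + h₂) + errF ψ R R₀ Dr A x (n + h₂) + errG χ ψ R x (n + h₂))
      ≤ ∑ n ∈ Icc 1 x, 3 * Real.log x * Real.log (2 * x) * ∑ d₁ ∈ T, ∑ d₂ ∈ T, w' d₁ * w d₂ *
          ((selbergSieve ψ R (n + h₁) * (if d₁ ∣ n + h₁ then 1 else 0)) *
            (selbergSieve ψ R (n + h₂) * (if d₂ ∣ n + h₂ then 1 else 0))) :=
        Finset.sum_le_sum hpt
    _ = 3 * Real.log x * Real.log (2 * x) * ∑ d₁ ∈ T, ∑ d₂ ∈ T, w' d₁ * w d₂ *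
          sieveCorrelation ψ R h₁ h₂ ![d₁, d₂] x := by
        rw [← Finset.mul_sum, Finset.sum_comm]
        congr 1
        refine Finset.sum_congr rfl fun d₁ _ => ?_
        rw [Finset.sum_comm]
        refine Finset.sum_congr rfl fun d₂ _ => ?_
        rw [← Finset.mul_sum]
        congr 1


/-! ### The hypothesis of Lemma 3.4 for the weights of (5.8) -/

/-- A smooth number has its prime factors below the threshold. [folklore] -/
theorem primeFactors_subset_of_mem_smoothNumbers {N d : ℕ} (hd : d ∈ Nat.smoothNumbers N) :
    d.primeFactors ⊆ Nat.primesBelow N := by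
  intro p hp
  rw [Nat.mem_primeFactors] at hp
  exact Nat.mem_primesBelow.mpr ⟨(Nat.mem_smoothNumbers'.mp hd) p hp.1 hp.2.1, hp.1⟩

/-- A number `d ≤ K` with prime factors in `S` divides `Q_S(K)`. [folklore] -/
theorem dvd_primePowerProd_of_subset {S : Finset ℕ} (hS : ∀ p ∈ S, p.Prime) {K d : ℕ} (hd : d ≠ 0)
    (hdS : d.primeFactors ⊆ S) (hdK : d ≤ K) : d ∣ primePowerProd S K := by
  rw [← Nat.factorization_le_iff_dvd hd (primePowerProd_ne_zero hS K)]
  intro p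
  rw [factorization_primePowerProd hS K p]
  by_cases hp : p ∈ S
  · rw [if_pos hp]
    exact ((Nat.factorization_lt p hd).le).trans hdK
  · rw [if_neg hp]
    have : p ∉ d.primeFactors := fun h => hp (hdS h)
    rw [← Nat.support_factorization, Finsupp.notMem_support_iff] at this
    rw [this]

/-- **The hypothesis of Lemma 3.4 for the weights of (5.8)**: with `M' = ⌊R₀⌋ ≥ 2`, `M' < R`,
`σ ≥ 1`: `∑_{d₁,d₂ ∈ T} 1_{d₁>1} w(d₁) w(d₂) gainWeight(R; (d₁,d₂); σ) ≤ N_A 2^{N_A} (log M'/log R) σ^{N_A+1}`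
(domination by `Φ`, extension to all pairs of divisors of `Q_S(⌊D⌋)` other than `(1,1)`, Euler
product, (3.3)). [cite: TaoTeravainen2021, §5 (proof of (5.8))] -/
theorem fWeight_gain_sum_le {R R₀ : ℝ} (hM' : 2 ≤ ⌊R₀⌋₊) (hM'R : ((⌊R₀⌋₊ : ℕ) : ℝ) < R) (Dr : ℝ)
    (A : ℕ) {σ : ℝ} (hσ : 1 ≤ σ) :
    ∑ dd ∈ fRange Dr ×ˢ fRange Dr,
        (if 1 < dd.1 then fWeight R₀ Dr A dd.1 else 0) * fWeight R₀ Dr A dd.2 *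
          gainWeight R ![dd.1, dd.2] σ ≤
      (expN A : ℝ) * 2 ^ expN A * (Real.log (⌊R₀⌋₊ : ℕ) / Real.log R) * σ ^ (expN A + 1) := by
  classical
  set M' := ⌊R₀⌋₊ with hM'def
  set S := Nat.primesBelow (M' + 1) with hSdef
  set K := ⌊Dr⌋₊ with hKdef
  set Q := primePowerProd S K with hQdef
  have hS : ∀ p ∈ S, p.Prime := fun p hp => (Nat.mem_primesBelow.mp hp).2
  have hSR : ∀ p ∈ S, (p : ℝ) < R := fun p hp => by
    have : p ≤ M' := Nat.lt_succ_iff.mp (Nat.mem_primesBelow.mp hp).1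
    exact lt_of_le_of_lt (by exact_mod_cast this) hM'R
  have hM'2 : (2 : ℝ) ≤ (M' : ℝ) := by exact_mod_cast hM'
  have hR : 1 < R := by linarith
  have hσ0 : 0 ≤ σ := by linarith
  set g : ℕ × ℕ → ℝ := fun dd =>
    if 1 < dd.1 ∧ dd.1 ∈ Nat.smoothNumbers (M' + 1) ∧ dd.2 ∈ Nat.smoothNumbers (M' + 1) then
      pairW S R σ A dd.1 dd.2 else 0 with hgdef
  have hPW0 : ∀ dd : ℕ × ℕ, 0 ≤ pairW S R σ A dd.1 dd.2 := fun dd => pairW_nonneg hS hR hσ0 A _ _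
  have hg0 : ∀ dd, 0 ≤ g dd := fun dd => by
    simp only [hgdef]
    split_ifs
    · exact hPW0 dd
    · exact le_rfl
  -- termwise domination
  have hterm : ∀ dd ∈ fRange Dr ×ˢ fRange Dr,
      (if 1 < dd.1 then fWeight R₀ Dr A dd.1 else 0) * fWeight R₀ Dr A dd.2 *
        gainWeight R ![dd.1, dd.2] σ ≤ g dd := by
    intro dd hdd
    rw [Finset.mem_product] at hdd
    have hd1 : 1 ≤ dd.1 := (Finset.mem_Icc.mp hdd.1).1
    have hd2 : 1 ≤ dd.2 := (Finset.mem_Icc.mp hdd.2).1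
    have hgw0 : 0 ≤ gainWeight R ![dd.1, dd.2] σ := gainWeight_nonneg hR _ hσ0
    by_cases hc : 1 < dd.1 ∧ dd.1 ∈ Nat.smoothNumbers (M' + 1) ∧ dd.2 ∈ Nat.smoothNumbers (M' + 1)
    · simp only [hgdef, if_pos hc, if_pos hc.1]
      unfold fWeight
      by_cases h1 : ((dd.1 : ℝ) ≤ Dr ∧ dd.1 ∈ Nat.smoothNumbers (⌊R₀⌋₊ + 1))
      · by_cases h2 : ((dd.2 : ℝ) ≤ Dr ∧ dd.2 ∈ Nat.smoothNumbers (⌊R₀⌋₊ + 1))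
        · rw [if_pos h1, if_pos h2]
          exact tau_pow_mul_gainWeight_le hR hσ A (by omega) (by omega)
            (primeFactors_subset_of_mem_smoothNumbers hc.2.1)
            (primeFactors_subset_of_mem_smoothNumbers hc.2.2)
        · rw [if_neg h2, mul_zero, zero_mul]
          exact hPW0 dd
      · rw [if_neg h1, zero_mul, zero_mul]
        exact hPW0 dd
    · simp only [hgdef, if_neg hc]
      -- one of the indicator conditions fails, so the weight vanishes
      by_cases h1 : 1 < dd.1
      · rw [if_pos h1]
        have : fWeight R₀ Dr A dd.1 * fWeight R₀ Dr A dd.2 = 0 := by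
          unfold fWeight
          by_cases hs1 : dd.1 ∈ Nat.smoothNumbers (M' + 1)
          · have hs2 : dd.2 ∉ Nat.smoothNumbers (M' + 1) := fun h => hc ⟨h1, hs1, h⟩
            rw [mul_comm, if_neg (fun h => hs2 h.2), zero_mul]
          · rw [if_neg (fun h => hs1 h.2), zero_mul]
        rw [this, zero_mul]
      · rw [if_neg h1, zero_mul, zero_mul]
  -- the good pairs are pairs of divisors of `Q` other than `(1,1)`
  have hsum_g : ∑ dd ∈ fRange Dr ×ˢ fRange Dr, g dd ≤
      ∑ dd ∈ (Q.divisors ×ˢ Q.divisors).erase (1, 1), pairW S R σ A dd.1 dd.2 := by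
    rw [hgdef, ← Finset.sum_filter]
    refine Finset.sum_le_sum_of_subset_of_nonneg (fun dd hdd => ?_) fun dd _ _ => hPW0 dd
    rw [Finset.mem_filter, Finset.mem_product] at hdd
    obtain ⟨⟨hT1, hT2⟩, h1, hs1, hs2⟩ := hdd
    have hK1 : dd.1 ≤ K := (Finset.mem_Icc.mp hT1).2
    have hK2 : dd.2 ≤ K := (Finset.mem_Icc.mp hT2).2
    have hd2 : 1 ≤ dd.2 := (Finset.mem_Icc.mp hT2).1
    have hQ0 : Q ≠ 0 := primePowerProd_ne_zero hS K
    rw [Finset.mem_erase, Finset.mem_product, Nat.mem_divisors, Nat.mem_divisors]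
    refine ⟨fun h => ?_, ⟨dvd_primePowerProd_of_subset hS (by omega)
      (primeFactors_subset_of_mem_smoothNumbers hs1) hK1, hQ0⟩,
      ⟨dvd_primePowerProd_of_subset hS (by omega) (primeFactors_subset_of_mem_smoothNumbers hs2) hK2, hQ0⟩⟩
    have := (Prod.ext_iff.mp h).1
    simp only at this
    omega
  calc ∑ dd ∈ fRange Dr ×ˢ fRange Dr,
        (if 1 < dd.1 then fWeight R₀ Dr A dd.1 else 0) * fWeight R₀ Dr A dd.2 *
          gainWeight R ![dd.1, dd.2] σ
      ≤ ∑ dd ∈ fRange Dr ×ˢ fRange Dr, g dd := Finset.sum_le_sum hterm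
    _ ≤ ∑ dd ∈ (Q.divisors ×ˢ Q.divisors).erase (1, 1), pairW S R σ A dd.1 dd.2 := hsum_g
    _ ≤ _ := sum_pairW_erase_le hM' hM'R hσ A K

/-! ### The size of the weights (divisor bound) -/

/-- **`∑_{d₁,d₂ ∈ T} 1_{d₁>1} w(d₁) w(d₂) ≤ C_τ^{2A} D^{5/2}`** where `τ(n) ≤ C_τ n^{1/(4(A+1))}`
(the divisor bound), since `w(d) ≤ τ(d)^A ≤ C_τ^A D^{1/4}` on `T` and `#T ≤ D`.
[cite: TaoTeravainen2021, §5 (proof of (5.8): the error term `R^{2k} D^{k+1} (log^k x)/x`)] -/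
theorem fWeight_sum_le {Cτ : ℝ} (hCτ1 : 1 ≤ Cτ) {A : ℕ}
    (hτ : ∀ n : ℕ, n ≠ 0 → ((n.divisors.card : ℕ) : ℝ) ≤ Cτ * (n : ℝ) ^ (1 / (4 * ((A : ℝ) + 1))))
    (R₀ : ℝ) {Dr : ℝ} (hDr : 1 ≤ Dr) :
    ∑ dd ∈ fRange Dr ×ˢ fRange Dr,
        (if 1 < dd.1 then fWeight R₀ Dr A dd.1 else 0) * fWeight R₀ Dr A dd.2 ≤
      Cτ ^ (2 * A) * Dr ^ ((5 : ℝ) / 2) := by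
  have hDr0 : 0 < Dr := by linarith
  -- `w(d) ≤ Cτ^A Dr^{1/4}` on `T`
  have hw : ∀ d ∈ fRange Dr, fWeight R₀ Dr A d ≤ Cτ ^ A * Dr ^ ((1 : ℝ) / 4) := by
    intro d hd
    have hd1 : 1 ≤ d := (Finset.mem_Icc.mp hd).1
    have hdD : (d : ℝ) ≤ Dr := le_trans (by exact_mod_cast (Finset.mem_Icc.mp hd).2) (Nat.floor_le hDr0.le)
    have hd0 : (1 : ℝ) ≤ d := by exact_mod_cast hd1
    have hτd := hτ d (by omega)
    have hbound : ((d.divisors.card : ℕ) : ℝ) ^ A ≤ Cτ ^ A * Dr ^ ((1 : ℝ) / 4) := by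
      calc ((d.divisors.card : ℕ) : ℝ) ^ A ≤ (Cτ * (d : ℝ) ^ (1 / (4 * ((A : ℝ) + 1)))) ^ A :=
            pow_le_pow_left₀ (Nat.cast_nonneg _) hτd A
        _ = Cτ ^ A * (d : ℝ) ^ ((A : ℝ) / (4 * ((A : ℝ) + 1))) := by
            rw [mul_pow, ← Real.rpow_natCast ((d : ℝ) ^ _), ← Real.rpow_mul (by positivity)]
            congr 2
            ring
        _ ≤ Cτ ^ A * (d : ℝ) ^ ((1 : ℝ) / 4) := by
            refine mul_le_mul_of_nonneg_left (Real.rpow_le_rpow_of_exponent_le hd0 ?_) (by positivity)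
            rw [div_le_div_iff₀ (by positivity) (by norm_num)]
            nlinarith
        _ ≤ Cτ ^ A * Dr ^ ((1 : ℝ) / 4) :=
            mul_le_mul_of_nonneg_left (Real.rpow_le_rpow (by positivity) hdD (by norm_num)) (by positivity)
    unfold fWeight
    split_ifs
    · exact hbound
    · positivity
  have hw0 : ∀ d, 0 ≤ fWeight R₀ Dr A d := fun d => fWeight_nonneg _ _ _ _
  have hcard : ((fRange Dr).card : ℝ) ≤ Dr := by
    unfold fRange
    rw [Nat.card_Icc, Nat.add_sub_cancel]
    exact Nat.floor_le hDr0.le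
  have hT : ∑ d ∈ fRange Dr, fWeight R₀ Dr A d ≤ Dr * (Cτ ^ A * Dr ^ ((1 : ℝ) / 4)) := by
    calc ∑ d ∈ fRange Dr, fWeight R₀ Dr A d ≤ ∑ _d ∈ fRange Dr, Cτ ^ A * Dr ^ ((1 : ℝ) / 4) :=
          Finset.sum_le_sum hw
      _ = (fRange Dr).card * (Cτ ^ A * Dr ^ ((1 : ℝ) / 4)) := by rw [Finset.sum_const, nsmul_eq_mul]
      _ ≤ Dr * (Cτ ^ A * Dr ^ ((1 : ℝ) / 4)) := mul_le_mul_of_nonneg_right hcard (by positivity)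
  have hT0 : 0 ≤ ∑ d ∈ fRange Dr, fWeight R₀ Dr A d := Finset.sum_nonneg fun d _ => hw0 d
  calc ∑ dd ∈ fRange Dr ×ˢ fRange Dr,
        (if 1 < dd.1 then fWeight R₀ Dr A dd.1 else 0) * fWeight R₀ Dr A dd.2
      ≤ ∑ dd ∈ fRange Dr ×ˢ fRange Dr, fWeight R₀ Dr A dd.1 * fWeight R₀ Dr A dd.2 := by
        refine Finset.sum_le_sum fun dd _ => mul_le_mul_of_nonneg_right ?_ (hw0 _)
        split_ifs
        · exact le_rfl
        · exact hw0 _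
    _ = (∑ d ∈ fRange Dr, fWeight R₀ Dr A d) * ∑ d ∈ fRange Dr, fWeight R₀ Dr A d := by
        rw [Finset.sum_mul_sum, Finset.sum_product]
    _ ≤ (Dr * (Cτ ^ A * Dr ^ ((1 : ℝ) / 4))) * (Dr * (Cτ ^ A * Dr ^ ((1 : ℝ) / 4))) :=
        mul_le_mul hT hT hT0 (by positivity)
    _ = Cτ ^ (2 * A) * (Dr * Dr ^ ((1 : ℝ) / 4)) ^ 2 := by ring
    _ = Cτ ^ (2 * A) * Dr ^ ((5 : ℝ) / 2) := by
        congr 1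
        rw [show Dr * Dr ^ ((1 : ℝ) / 4) = Dr ^ ((5 : ℝ) / 4) by
          rw [show (5 : ℝ) / 4 = 1 + 1 / 4 by norm_num, Real.rpow_add hDr0, Real.rpow_one]]
        rw [← Real.rpow_natCast, ← Real.rpow_mul hDr0.le]
        norm_num


/-! ### Small analytic inequalities -/

/-- `u² ≤ 32 e^{u/4}` for `u ≥ 0`. [folklore] -/
theorem sq_le_exp_quarter {u : ℝ} (hu : 0 ≤ u) : u ^ 2 ≤ 32 * Real.exp (u / 4) := by
  have h := @Real.pow_div_factorial_le_exp (u / 4) (by positivity) 2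
  rw [Nat.factorial_two] at h
  push_cast at h
  rw [div_le_iff₀ (by norm_num : (0 : ℝ) < 2)] at h
  nlinarith

/-- `log ℓ ≤ u/8` when `ℓ ≥ 2` and `ℓ^{10} ≤ u`. [folklore] -/
theorem log_le_of_pow_ten_le {ℓ u : ℝ} (hℓ : 2 ≤ ℓ) (hu : ℓ ^ 10 ≤ u) : Real.log ℓ ≤ u / 8 := by
  have h1 : Real.log ℓ ≤ ℓ := (Real.log_le_sub_one_of_pos (by linarith)).trans (by linarith)
  have h2 : 8 * ℓ ≤ ℓ ^ 10 := by
    have : (2 : ℝ) ^ 9 ≤ ℓ ^ 9 := pow_le_pow_left₀ (by norm_num) hℓ 9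
    nlinarith
  linarith

end TaoTeravainen

set_option maxHeartbeats 2000000 in
open TaoTeravainen in
/-- **Tao–Teräväinen 2022, (5.8) for `k = 2`, `ℓ = 0` — PROVED** (`TaoTeravainen2021_eq58_pair`):
"`𝔼_{n ≤ x} F(n+h₁) ∏_{j=2}^k (Λν + F + G)(n+h_j) ≈ 0`". Proof as printed: the pointwise bounds
`Λν, F, G ≪ (∑_{d ≤ D, d∣·} τ_{(≤R₀)}(d)^{O(1)}) ν log x` reduce to weighted correlation sums
`∑_{d₁ > 1, d₂} τ(d₁)^A τ(d₂)^A 𝔼 ν(n+h₁)1_{d₁∣n+h₁} ν(n+h₂)1_{d₂∣n+h₂}` over `R₀`-smooth moduli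
(`sum_errF_mul_le`); Lemma 3.4 (`sieveCorrelation_weighted_le`) with the Euler product bound
`∏_{p ≤ R₀} E'_p(σ) - 1 ≤ (1 + σ log_R R₀)^{O_A(1)} - 1 ≪ σ^{O_A(1)} log_R R₀` (`fWeight_gain_sum_le`,
from (2.11) and (3.3)) gives the main term `≪ log² x · log_R R₀/log² R = log^{-1/5} η` and the error
`≪ R⁴ D^{5/2} log² x / x` (divisor bound); with `R = x^{1/log^{1/10} η}`, `R₀ = x^{1/√log η}`,
`D = x^{ε₀/20}`, `ε₀ ≤ 1` and Siegel's bound (1.4) both are `≤ C/log^{1/20} η` for `η ≥ η₁`.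
Constants: `C = 96 C_K J⁴ N 2^N + 3072 B⁴ C_τ^{2A}` (`N = expN A`, `J = momentConst ψ (216+N+1)`,
`C_τ` the divisor-bound constant at exponent `1/(4(A+1))`).
[cite: TaoTeravainen2021, §5, proof of Proposition 5.2, (5.8); Lemma 3.4; (2.11), (3.3), (2.3)–(2.5), (1.4)] -/
theorem TaoTeravainen2021_eq58_pair_holds : TaoTeravainen2021_eq58_pair := by
  intro h₁ h₂ hh₁ hh₂ hne ψ hψ
  refine ⟨1, one_pos, fun ε₀ hε₀ hε₀1 A => ?_⟩
  classical
  obtain ⟨B, hB0, hB⟩ := hψ.exists_abs_le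
  obtain ⟨CS, hCS, hSiegel⟩ := exists_siegelZero_quality_le one_pos
  have hεA : (0 : ℝ) < 1 / (4 * ((A : ℝ) + 1)) := by positivity
  obtain ⟨Cτ, hCτ1, hτ⟩ := Literature.NumberTheory.Sieve.exists_card_divisors_le_mul_rpow hεA
  -- constants
  set N : ℕ := expN A with hNdef
  set CK : ℝ := kernelConst h₁ h₂ with hCKdef
  set J : ℝ := momentConst ψ (216 + (N + 1)) with hJdef
  set Cmain : ℝ := 96 * CK * J ^ 4 * N * 2 ^ N with hCmaindef
  set Cerr : ℝ := 3072 * B ^ 4 * Cτ ^ (2 * A) with hCerrdef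
  set cS : ℝ := 1 + |Real.log CS| with hcSdef
  set M₀ : ℝ := 10 * cS + 10 with hM₀def
  have hCK0 : 0 < CK := kernelConst_pos hne
  have hJ0 : 0 ≤ J := momentConst_nonneg ψ _
  have hCmain0 : 0 ≤ Cmain := by positivity
  have hCerr0 : 0 ≤ Cerr := by positivity
  have hcS1 : 1 ≤ cS := by
    have := abs_nonneg (Real.log CS)
    rw [hcSdef]; linarith
  have hcS0 : 0 < cS := by linarith
  have hM₀10 : 10 ≤ M₀ := by rw [hM₀def]; linarith
  have hM₀0 : 0 ≤ M₀ := by linarith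
  refine ⟨Cmain + Cerr, max (Real.exp 1024) (max (Real.exp (M₀ ^ 20)) (CS * max h₁ h₂)), ?_⟩
  intro q _ χ η hS hη x hxlo hxhi
  -- thresholds
  have hη1024 : Real.exp 1024 ≤ η := le_trans (le_max_left _ _) hη
  have hηM : Real.exp (M₀ ^ 20) ≤ η := le_trans ((le_max_left _ _).trans (le_max_right _ _)) hη
  have hηh : CS * ((max h₁ h₂ : ℕ) : ℝ) ≤ η := le_trans ((le_max_right _ _).trans (le_max_right _ _)) hη
  -- sizes of `η`, `q`, `x`
  have hη0 : 0 < η := (Real.exp_pos _).trans_le hη1024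
  have hlogη : 1024 ≤ Real.log η := by
    rw [← Real.log_exp 1024]; exact Real.log_le_log (Real.exp_pos _) hη1024
  have hlogη0 : 0 < Real.log η := by linarith
  have hq3 : (3 : ℝ) ≤ q := by exact_mod_cast hS.three_le
  have hqx : (q : ℝ) ≤ x :=
    calc (q : ℝ) = (q : ℝ) ^ (1 : ℝ) := (Real.rpow_one _).symm
      _ ≤ (q : ℝ) ^ ((41 : ℝ) / 2 + ε₀) := Real.rpow_le_rpow_of_exponent_le (by linarith) (by linarith)
      _ ≤ x := hxlo
  have hx3 : (3 : ℝ) ≤ x := hq3.trans hqx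
  have hx1 : (1 : ℝ) ≤ x := by linarith
  have hx0 : (0 : ℝ) < x := by linarith
  have hx2 : 2 ≤ x := by exact_mod_cast (show (2 : ℝ) ≤ x by linarith)
  have hηx : η ≤ CS * x := by
    have h1 := hSiegel q χ η hS
    rw [Real.rpow_one] at h1
    exact h1.trans (mul_le_mul_of_nonneg_left hqx hCS.le)
  have hhx : ((max h₁ h₂ : ℕ) : ℝ) ≤ x := le_of_mul_le_mul_left (hηh.trans hηx) hCS
  have hhx' : max h₁ h₂ ≤ x := by exact_mod_cast hhx
  have hh₂x : h₂ ≤ x := (le_max_right h₁ h₂).trans hhx'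
  -- `u = log x`, `ℓ = log^{1/20} η ≥ M₀`
  set u : ℝ := Real.log x with hudef
  have hu1 : 1 ≤ u := (Real.le_log_iff_exp_le hx0).mpr (by linarith [Real.exp_one_lt_d9])
  have hu0 : 0 < u := by linarith
  have hxu : Real.exp u = x := by rw [hudef, Real.exp_log hx0]
  set ℓ : ℝ := Real.log η ^ ((1 : ℝ) / 20) with hℓdef
  have hℓ0 : 0 < ℓ := Real.rpow_pos_of_pos hlogη0 _
  have hℓ20 : ℓ ^ 20 = Real.log η := by
    rw [hℓdef, ← Real.rpow_natCast, ← Real.rpow_mul hlogη0.le]; norm_num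
  have hℓ2 : ℓ ^ 2 = Real.log η ^ ((1 : ℝ) / 10) := by
    rw [hℓdef, ← Real.rpow_natCast, ← Real.rpow_mul hlogη0.le]; norm_num
  have hℓ10 : ℓ ^ 10 = Real.sqrt (Real.log η) := by
    rw [hℓdef, ← Real.rpow_natCast, ← Real.rpow_mul hlogη0.le, Real.sqrt_eq_rpow]; norm_num
  have hℓM : M₀ ≤ ℓ := by
    have h1 : M₀ ^ 20 ≤ Real.log η := by
      rw [← Real.log_exp (M₀ ^ 20)]; exact Real.log_le_log (Real.exp_pos _) hηM
    have h2 : (M₀ ^ 20) ^ ((1 : ℝ) / 20) ≤ ℓ := Real.rpow_le_rpow (by positivity) h1 (by norm_num)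
    rwa [← Real.rpow_natCast, ← Real.rpow_mul hM₀0, show ((20 : ℕ) : ℝ) * (1 / 20) = 1 by norm_num,
      Real.rpow_one] at h2
  have hℓ1 : 1 ≤ ℓ := by linarith
  have hℓ3 : 3 ≤ ℓ := by linarith
  -- `log η ≤ c_S u`
  have hlogη_le : Real.log η ≤ cS * u := by
    have h1 : Real.log η ≤ Real.log CS + u := by
      rw [hudef, ← Real.log_mul hCS.ne' hx0.ne']; exact Real.log_le_log hη0 hηx
    have h2 : Real.log CS ≤ |Real.log CS| * u :=
      (le_abs_self _).trans (le_mul_of_one_le_right (abs_nonneg _) hu1)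
    rw [hcSdef]; linarith
  -- `R = e^t`, `t = u/ℓ²`
  set R : ℝ := pairScaleR η x with hRdef
  set t : ℝ := u / ℓ ^ 2 with htdef
  have hℓ2pos : 0 < ℓ ^ 2 := by positivity
  have ht0 : 0 < t := div_pos hu0 hℓ2pos
  have hut : u = t * ℓ ^ 2 := by rw [htdef]; field_simp
  have hRexp : R = Real.exp t := by
    rw [hRdef]; unfold pairScaleR
    rw [← hℓ2, Real.rpow_def_of_pos hx0, htdef, hudef]; congr 1; ring
  have hlogR : Real.log R = t := by rw [hRexp, Real.log_exp]
  -- `u ≥ ℓ^{20}/c_S ≥ ℓ^{10}` and `t ≥ 10`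
  have huℓ : ℓ ^ 10 ≤ u := by
    have h1 : ℓ ^ 20 ≤ cS * u := hℓ20 ▸ hlogη_le
    have h2 : cS ≤ ℓ ^ 10 := by
      have : cS ≤ ℓ := by rw [hM₀def] at hℓM; linarith
      exact this.trans (le_self_pow₀ hℓ1 (by norm_num))
    have h3 : ℓ ^ 10 * ℓ ^ 10 ≤ cS * u := by rw [← pow_add]; exact h1
    nlinarith [pow_pos hℓ0 10]
  have ht_ge : ℓ ^ 18 ≤ cS * t := by
    have h1 : ℓ ^ 18 * ℓ ^ 2 ≤ cS * t * ℓ ^ 2 := by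
      have : ℓ ^ 18 * ℓ ^ 2 = Real.log η := by rw [← hℓ20]; ring
      rw [this, mul_assoc, ← hut]; exact hlogη_le
    exact le_of_mul_le_mul_right h1 hℓ2pos
  have ht10 : 10 ≤ t := by
    have hℓ18 : ℓ ≤ ℓ ^ 18 := le_self_pow₀ hℓ1 (by norm_num)
    have h1 : cS * 10 ≤ cS * t := by
      have : 10 * cS ≤ ℓ := by rw [hM₀def] at hℓM; linarith
      linarith
    exact le_of_mul_le_mul_left h1 hcS0
  have hR3 : 3 ≤ R := by rw [hRexp]; linarith [Real.add_one_le_exp t]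
  have hR1 : 1 < R := by linarith
  have hR0 : 0 < R := by linarith
  have hRsqrt : R ≤ Real.sqrt x := pairScaleR_le_sqrt hη1024 hx1
  -- `R₀ = e^{u/ℓ^{10}}`, `M' = ⌊R₀⌋`
  set R₀ : ℝ := scaleR0 η x with hR₀def
  have hR₀exp : R₀ = Real.exp (u / ℓ ^ 10) := by
    rw [hR₀def]; unfold scaleR0
    rw [← hℓ10, Real.rpow_def_of_pos hx0, hudef]; congr 1; ring
  have hℓ10pos : 0 < ℓ ^ 10 := by positivity
  have hR₀2 : (2 : ℝ) ≤ R₀ := by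
    have h1 : 1 ≤ u / ℓ ^ 10 := by rw [le_div_iff₀ hℓ10pos, one_mul]; exact huℓ
    rw [hR₀exp]
    linarith [Real.add_one_le_exp (u / ℓ ^ 10)]
  set M' : ℕ := ⌊R₀⌋₊ with hM'def
  have hM'2 : 2 ≤ M' := Nat.le_floor (by exact_mod_cast hR₀2)
  have hM'R₀ : (M' : ℝ) ≤ R₀ := Nat.floor_le (by linarith)
  have hR₀R : R₀ < R := by
    rw [hR₀exp, hRexp, Real.exp_lt_exp, htdef]
    refine div_lt_div_of_pos_left hu0 hℓ2pos ?_
    calc ℓ ^ 2 < ℓ ^ 2 * ℓ ^ 8 := lt_mul_of_one_lt_right hℓ2pos (one_lt_pow₀ (by linarith) (by norm_num))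
      _ = ℓ ^ 10 := by ring
  have hM'R : (M' : ℝ) < R := hM'R₀.trans_lt hR₀R
  have hlogM' : Real.log (M' : ℝ) / Real.log R ≤ 1 / ℓ ^ 8 := by
    have h1 : Real.log (M' : ℝ) ≤ u / ℓ ^ 10 := by
      calc Real.log (M' : ℝ) ≤ Real.log R₀ := Real.log_le_log (by positivity) hM'R₀
        _ = u / ℓ ^ 10 := by rw [hR₀exp, Real.log_exp]
    rw [hlogR, div_le_iff₀ ht0]
    calc Real.log (M' : ℝ) ≤ u / ℓ ^ 10 := h1
      _ = 1 / ℓ ^ 8 * t := by rw [hut]; field_simp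
  -- `D = e^{ε₀ u/20} ≥ 1`
  set Dr : ℝ := scaleD 2 ε₀ x with hDrdef
  have hDrexp : Dr = Real.exp (u * (ε₀ / 20)) := by
    rw [hDrdef]; unfold scaleD
    rw [Real.rpow_def_of_pos hx0, hudef]; congr 1; ring
  have hDr1 : 1 ≤ Dr := by
    rw [hDrexp]; exact Real.one_le_exp (by positivity)
  have hDr52 : Dr ^ ((5 : ℝ) / 2) ≤ Real.exp (u / 8) := by
    rw [hDrexp, ← Real.exp_mul, Real.exp_le_exp]
    nlinarith
  -- Step 1: reduction
  have hred := sum_errF_mul_le χ hψ hR1 hRsqrt hh₂x hx2 R₀ hDr1 A (h₁ := h₁)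
  set T := fRange Dr with hTdef
  set w : ℕ → ℝ := fun d => fWeight R₀ Dr A d with hwdef
  set w' : ℕ → ℝ := fun d => if 1 < d then fWeight R₀ Dr A d else 0 with hw'def
  have hw0 : ∀ d, 0 ≤ w d := fun d => fWeight_nonneg _ _ _ _
  have hw'0 : ∀ d, 0 ≤ w' d := fun d => by
    simp only [hw'def]; split_ifs
    · exact fWeight_nonneg _ _ _ _
    · exact le_rfl
  -- Step 2: Lemma 3.4 in the weighted form
  set emb : ℕ × ℕ → (Fin 2 → ℕ) := fun dd => ![dd.1, dd.2] with hembdef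
  have hemb_inj : Set.InjOn emb ↑(T ×ˢ T) := by
    intro a _ b _ hab
    have h0 := congrFun hab 0
    have h1 := congrFun hab 1
    simp only [hembdef, Matrix.cons_val_zero, Matrix.cons_val_one] at h0 h1
    exact Prod.ext h0 h1
  set D : Finset (Fin 2 → ℕ) := (T ×ˢ T).image emb with hDdef
  set a : (Fin 2 → ℕ) → ℝ := fun d => w' (d 0) * w (d 1) with hadef
  have ha0 : ∀ d ∈ D, 0 ≤ a d := fun d _ => mul_nonneg (hw'0 _) (hw0 _)
  have hD0 : ∀ d ∈ D, ∀ j, d j ≠ 0 := by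
    intro d hd j
    rw [hDdef, Finset.mem_image] at hd
    obtain ⟨dd, hdd, rfl⟩ := hd
    rw [Finset.mem_product] at hdd
    have h1 : 1 ≤ dd.1 := (Finset.mem_Icc.mp hdd.1).1
    have h2 : 1 ≤ dd.2 := (Finset.mem_Icc.mp hdd.2).1
    fin_cases j
    · simp [hembdef]; omega
    · simp [hembdef]; omega
  -- sums over `D` are sums over `T × T`
  have hsumD : ∀ F : (Fin 2 → ℕ) → ℝ, ∑ d ∈ D, a d * F d =
      ∑ dd ∈ T ×ˢ T, w' dd.1 * w dd.2 * F (emb dd) := by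
    intro F
    rw [hDdef, Finset.sum_image hemb_inj]
    refine Finset.sum_congr rfl fun dd _ => ?_
    simp [hadef, hembdef]
  set Mg : ℝ := (N : ℝ) * 2 ^ N * (Real.log (M' : ℝ) / Real.log R) with hMgdef
  have hMg0 : 0 ≤ Mg := by
    have : 0 ≤ Real.log (M' : ℝ) / Real.log R :=
      div_nonneg (Real.log_nonneg (by exact_mod_cast (show 1 ≤ M' by omega))) (by rw [hlogR]; exact ht0.le)
    positivity
  have hMhyp : ∀ σ : ℝ, 1 ≤ σ → ∑ d ∈ D, a d * gainWeight R d σ ≤ Mg * σ ^ (N + 1) := by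
    intro σ hσ
    rw [hsumD]
    exact fWeight_gain_sum_le hM'2 hM'R Dr A hσ
  have h34 := sieveCorrelation_weighted_le hψ hB hne hR3 D hD0 a ha0 hMhyp x
  -- the weighted correlation sum in the two forms
  have hSform : ∑ d₁ ∈ T, ∑ d₂ ∈ T, w' d₁ * w d₂ * sieveCorrelation ψ R h₁ h₂ ![d₁, d₂] x =
      ∑ d ∈ D, a d * sieveCorrelation ψ R h₁ h₂ d x := by
    rw [hsumD, Finset.sum_product]
  have hAform : ∑ d ∈ D, a d = ∑ dd ∈ T ×ˢ T, w' dd.1 * w dd.2 := by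
    have := hsumD (fun _ => 1)
    simpa using this
  -- Step 3: sizes
  have hSa : ∑ dd ∈ T ×ˢ T, w' dd.1 * w dd.2 ≤ Cτ ^ (2 * A) * Dr ^ ((5 : ℝ) / 2) :=
    fWeight_sum_le hCτ1 hτ R₀ hDr1
  set L : ℝ := Real.log (2 * x) with hLdef
  have hL : L ≤ 2 * u := by
    rw [hLdef, hudef, Real.log_mul (by norm_num) hx0.ne']
    have : Real.log 2 ≤ Real.log x := Real.log_le_log (by norm_num) (by linarith)
    linarith
  have hL0 : 0 ≤ L := Real.log_nonneg (by linarith)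
  have hceil : (B * ⌈R⌉₊) ^ 4 ≤ 16 * B ^ 4 * Real.exp (u / 2) := by
    have h1 : ((⌈R⌉₊ : ℕ) : ℝ) ≤ 2 * R := by
      have := Nat.ceil_lt_add_one hR0.le
      linarith
    have h2 : R ^ 4 ≤ Real.exp (u / 2) := by
      rw [hRexp, ← Real.exp_nat_mul, Real.exp_le_exp]
      push_cast
      rw [hut]
      have h9 : 9 ≤ ℓ ^ 2 := by nlinarith [hℓ3]
      nlinarith [mul_le_mul_of_nonneg_left h9 ht0.le]
    calc (B * ⌈R⌉₊) ^ 4 ≤ (B * (2 * R)) ^ 4 :=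
          pow_le_pow_left₀ (by positivity) (mul_le_mul_of_nonneg_left h1 hB0) 4
      _ = 16 * B ^ 4 * R ^ 4 := by ring
      _ ≤ 16 * B ^ 4 * Real.exp (u / 2) := mul_le_mul_of_nonneg_left h2 (by positivity)
  -- the goal
  rw [div_le_iff₀ hx0]
  have hgoalℓ : (Cmain + Cerr) / Real.log η ^ ((1 : ℝ) / 20) * x = (Cmain + Cerr) * x / ℓ := by
    rw [hℓdef]; ring
  rw [hgoalℓ]
  -- main term
  have hmain : 3 * u * L * ((x : ℝ) * (16 * kernelConst h₁ h₂ * Mg * momentConst ψ (216 + (N + 1)) ^ 4 /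
      Real.log R ^ 2)) ≤ Cmain * x / ℓ := by
    rw [hlogR, ← hCKdef, ← hJdef]
    have hMg : Mg ≤ (N : ℝ) * 2 ^ N * (1 / ℓ ^ 8) := mul_le_mul_of_nonneg_left hlogM' (by positivity)
    calc 3 * u * L * ((x : ℝ) * (16 * CK * Mg * J ^ 4 / t ^ 2))
        ≤ 3 * u * (2 * u) * ((x : ℝ) * (16 * CK * ((N : ℝ) * 2 ^ N * (1 / ℓ ^ 8)) * J ^ 4 / t ^ 2)) := by
          gcongr
      _ = Cmain * x * (u ^ 2 / (t ^ 2 * ℓ ^ 8)) := by rw [hCmaindef]; field_simp; ring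
      _ = Cmain * x * (1 / ℓ ^ 4) := by
          congr 1
          rw [hut]; field_simp
      _ ≤ Cmain * x * (1 / ℓ) := by
          refine mul_le_mul_of_nonneg_left ?_ (by positivity)
          exact div_le_div_of_nonneg_left zero_le_one hℓ0 (le_self_pow₀ hℓ1 (by norm_num))
      _ = Cmain * x / ℓ := by ring
  -- error term
  have herr : 3 * u * L * ((B * ⌈R⌉₊) ^ 4 * ∑ d ∈ D, a d) ≤ Cerr * x / ℓ := by
    rw [hAform]
    have hu2 := sq_le_exp_quarter hu0.le
    have hlogℓ : Real.log ℓ ≤ u / 8 := log_le_of_pow_ten_le (by linarith) huℓ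
    have hexpℓ : Real.exp (-(u / 8)) ≤ 1 / ℓ := by
      rw [Real.exp_neg, one_div, inv_le_inv₀ (Real.exp_pos _) hℓ0]
      calc ℓ = Real.exp (Real.log ℓ) := (Real.exp_log hℓ0).symm
        _ ≤ Real.exp (u / 8) := Real.exp_le_exp.mpr hlogℓ
    have hSa0 : 0 ≤ ∑ dd ∈ T ×ˢ T, w' dd.1 * w dd.2 :=
      Finset.sum_nonneg fun dd _ => mul_nonneg (hw'0 _) (hw0 _)
    calc 3 * u * L * ((B * ⌈R⌉₊) ^ 4 * ∑ dd ∈ T ×ˢ T, w' dd.1 * w dd.2)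
        ≤ 3 * u * (2 * u) * ((16 * B ^ 4 * Real.exp (u / 2)) * (Cτ ^ (2 * A) * Real.exp (u / 8))) := by
          have h1 : (B * ⌈R⌉₊) ^ 4 * ∑ dd ∈ T ×ˢ T, w' dd.1 * w dd.2 ≤
              (16 * B ^ 4 * Real.exp (u / 2)) * (Cτ ^ (2 * A) * Real.exp (u / 8)) :=
            mul_le_mul hceil (hSa.trans (mul_le_mul_of_nonneg_left hDr52 (by positivity))) hSa0
              (by positivity)
          have h2 : 3 * u * L ≤ 3 * u * (2 * u) := mul_le_mul_of_nonneg_left hL (by positivity)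
          exact mul_le_mul h2 h1 (by positivity) (by positivity)
      _ = 96 * B ^ 4 * Cτ ^ (2 * A) * (u ^ 2 * (Real.exp (u / 2) * Real.exp (u / 8))) := by ring
      _ ≤ 96 * B ^ 4 * Cτ ^ (2 * A) * (32 * Real.exp (u / 4) * (Real.exp (u / 2) * Real.exp (u / 8))) := by
          gcongr
      _ = Cerr * (Real.exp u * Real.exp (-(u / 8))) := by
          have e : Real.exp (u / 4) * (Real.exp (u / 2) * Real.exp (u / 8)) =
              Real.exp u * Real.exp (-(u / 8)) := by
            rw [← Real.exp_add, ← Real.exp_add, ← Real.exp_add]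
            congr 1
            ring
          rw [hCerrdef, show (32 : ℝ) * Real.exp (u / 4) * (Real.exp (u / 2) * Real.exp (u / 8)) =
            32 * (Real.exp (u / 4) * (Real.exp (u / 2) * Real.exp (u / 8))) by ring, e]
          ring
      _ ≤ Cerr * (Real.exp u * (1 / ℓ)) := by gcongr
      _ = Cerr * x / ℓ := by rw [hxu]; ring
  -- combine
  calc ∑ n ∈ Icc 1 x, pairErrF ψ η ε₀ A x (n + h₁) *
        (sievedVonMangoldt ψ (pairScaleR η x) (n + h₂) + pairErrF ψ η ε₀ A x (n + h₂) +
          pairErrG χ ψ η x (n + h₂))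
      ≤ 3 * Real.log x * Real.log (2 * x) *
          ∑ d₁ ∈ T, ∑ d₂ ∈ T, w' d₁ * w d₂ * sieveCorrelation ψ R h₁ h₂ ![d₁, d₂] x := hred
    _ = 3 * u * L * ∑ d ∈ D, a d * sieveCorrelation ψ R h₁ h₂ d x := by rw [hSform]
    _ ≤ 3 * u * L * ((x : ℝ) * (16 * kernelConst h₁ h₂ * Mg * momentConst ψ (216 + (N + 1)) ^ 4 /
          Real.log R ^ 2) + (B * ⌈R⌉₊) ^ 4 * ∑ d ∈ D, a d) :=
        mul_le_mul_of_nonneg_left h34 (by positivity)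
    _ = 3 * u * L * ((x : ℝ) * (16 * kernelConst h₁ h₂ * Mg * momentConst ψ (216 + (N + 1)) ^ 4 /
          Real.log R ^ 2)) + 3 * u * L * ((B * ⌈R⌉₊) ^ 4 * ∑ d ∈ D, a d) := by ring
    _ ≤ Cmain * x / ℓ + Cerr * x / ℓ := add_le_add hmain herr
    _ = (Cmain + Cerr) * x / ℓ := by ring

end Literature.Barriers.Parity
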